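import Summits.ABC.IUTFork.Joshi.ATS4DescentSpineVolFreeResidual
import HarnessLib

/-!
# [J-IV] (arXiv:2403.10430v2) §6.10–§7.1: the collapse of the ∃-form E5 spine's residual to ONE GLOBAL inequality needs NO negative
# component — free NONNEGATIVE `q`-components (fixed sum) suffice, even against GENUINE / nonnegative `d_{L′}`-components
# (R-J census row Y-21, parent word — sequel to the counted reader's rider `ATS4DescentSpineVolFreeResidual`)

Proof-only sequel (0 defs) of `Joshi/ATS4DescentSpineVolFreeResidual.lean` (abc-iut-E-t50 gen 8, p468721; R-J «JOSHI Y-DISCHARGE CENSUS»,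
rung LADDER-ABC:A2.RESCUE.J), answering in kernel the adversary question «is the balancing of `abc_of_globalInequality` an artefact of the
typing that allows `log d_{L′,p} < 0`?» — NO: with the `d_{L′}`-components `DLp p ≥ 0` SUPPLIED (any nonnegative family with the right sum,
e.g. E-t35's genuine fibre sums) and only the `q`-components FREE NONNEGATIVE reals with `Σ_{p∈V} qAt p = log 𝔮_F`, the antecedent of
E-t33's `abc_of_genuineResidual` (p464392) STILL collapses to the ONE GLOBAL (6.11.2)+lower-bound-shaped inequality. Mechanism
(`exists_nonneg_qComponents`): each prime `p ∈ V` ABSORBS `q`-mass up to its capacity `6·((1+4/ℓ)·DLp p + (4/ℓ)·log p + (20/3)·e*·ι_p·(log p)/p)`;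
fill the capacities proportionally, put any excess at one prime; the minimum over such distributions of `Σ_p max(0, −B_p)` is EXACTLY
`max(0, −Σ_p B_p)`. So the per-prime Step (v) shape is load-bearing ONLY when BOTH component families are genuine (E-t33's
`abc_of_genuineResidualSupport` / `…_reading3`; vol-free form `abc_of_volFreeResidualSupport`).
* `exists_nonneg_qComponents` — the capacity-filling lemma (pure real arithmetic on a finite set). [folklore]
* `abc_of_globalInequality_nonneg` — `ABC` from: per admissible point, the tower (R1), a non-empty three-way `V` (R2), NONNEGATIVE
  `d_{L′}`-components with sum `logDifferent K`, and the ONE global inequality; the `q`-components fed to `abc_of_volFreeResidual` are the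
  lemma's NONNEGATIVE ones. PROVED AS AN IMPLICATION (corollary of p464392 BY NAME); NO abc claim.
FRAMING (binding): real-number bookkeeping on E-t33's typed antecedent; NO side taken on [IUTchIII] Cor. 3.12 / [IUTchIV] Thm. 1.10, on
Joshi's claims or on Mochizuki's report on them; NOT an abc claim; typed ≠ proved ≠ endorsed. Theorems only; standard axioms; no `sorry`,
instance, notation, `def` or new `Prop`. [claim: Joshi2024ATS4, status: disputed] (locators as in the parents).
-/

noncomputable section

namespace Summit.ABC.IUTFork.Joshi.ATS4
open Literature.NumberTheory.DiophantineGeometry Literature.NumberTheory.DiophantineGeometry.GenEll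
open Literature.NumberTheory.EllipticCurves
open Literature.IUT.LogVolume Literature.IUT.LogVolume.Cor22
open Literature.NumberTheory.LFunctions
open NumberField IsDedekindDomain Finset
open scoped Classical

/-! ## 1. Capacity filling: nonnegative `q`-components realising the global positive part -/

/-- **Capacity-filling lemma.** On a finite `V ∋ p₀` with absorptive terms `a p ≥ 0`, a scale `κ ≥ 0`, a mass `Q ≥ 0` and a bound `R` with
`κ·(Q/6 − Σ_{p∈V} a p) ≤ R` and `0 ≤ R`, there are NONNEGATIVE `q p` with `Σ_{p∈V} q p = Q` and `Σ_{p∈V} max(0, κ·(q p/6 − a p)) ≤ R`: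
if `Q ≤ 6·Σa` (and `Σa > 0`) take `q p := Q·a p/Σa` (every bracket `≤ 0`); if `Q > 6·Σa` take `q p := 6·a p + (Q − 6·Σa)·[p = p₀]` (one
bracket `= (Q − 6Σa)/6`, the rest `0`); if `Σa = 0 = Q` take `q := 0`. [folklore] -/
theorem exists_nonneg_qComponents (V : Finset ℕ) {p₀ : ℕ} (hp₀ : p₀ ∈ V) (a : ℕ → ℝ) (ha : ∀ p ∈ V, 0 ≤ a p)
    {κ Q R : ℝ} (hκ : 0 ≤ κ) (hQ : 0 ≤ Q) (hR : 0 ≤ R) (hglob : κ * (Q / 6 - ∑ p ∈ V, a p) ≤ R) :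
    ∃ q : ℕ → ℝ, (∀ p ∈ V, 0 ≤ q p) ∧ ∑ p ∈ V, q p = Q ∧ ∑ p ∈ V, max 0 (κ * (q p / 6 - a p)) ≤ R := by
  set A : ℝ := ∑ p ∈ V, a p with hA
  have hA0 : 0 ≤ A := Finset.sum_nonneg ha
  by_cases hcase : Q ≤ 6 * A
  · by_cases hApos : 0 < A
    · -- proportional filling: every bracket is ≤ 0
      refine ⟨fun p => Q * a p / A, fun p hp => div_nonneg (mul_nonneg hQ (ha p hp)) hA0, ?_, ?_⟩
      · rw [← Finset.sum_div, ← Finset.mul_sum, ← hA]; field_simp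
      · have hterm : ∀ p ∈ V, max 0 (κ * (Q * a p / A / 6 - a p)) = 0 := by
          intro p hp
          refine max_eq_left ?_
          have h1 : Q * a p / A / 6 - a p = a p * (Q / (6 * A) - 1) := by field_simp
          have h2 : Q / (6 * A) - 1 ≤ 0 := by rw [sub_nonpos, div_le_one (by positivity)]; exact hcase
          rw [h1]
          exact mul_nonpos_of_nonneg_of_nonpos hκ (mul_nonpos_of_nonneg_of_nonpos (ha p hp) h2)
        rw [Finset.sum_congr rfl hterm, Finset.sum_const_zero]
        exact hR
    · -- `A = 0`, hence `Q = 0`: take `q := 0`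
      have hA00 : A = 0 := le_antisymm (not_lt.mp hApos) hA0
      have hQ0 : Q = 0 := le_antisymm (by rw [hA00, mul_zero] at hcase; exact hcase) hQ
      refine ⟨fun _ => 0, fun _ _ => le_rfl, by rw [Finset.sum_const_zero, hQ0], ?_⟩
      have hterm : ∀ p ∈ V, max 0 (κ * ((0 : ℝ) / 6 - a p)) = 0 := fun p hp =>
        max_eq_left (by rw [zero_div, zero_sub]; exact mul_nonpos_of_nonneg_of_nonpos hκ (neg_nonpos.mpr (ha p hp)))
      rw [Finset.sum_congr rfl hterm, Finset.sum_const_zero]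
      exact hR
  · -- excess `Q − 6A > 0` placed at `p₀`
    have hexc : 0 < Q - 6 * A := by linarith
    refine ⟨fun p => 6 * a p + (if p = p₀ then Q - 6 * A else 0), fun p hp => ?_, ?_, ?_⟩
    · show 0 ≤ 6 * a p + (if p = p₀ then Q - 6 * A else 0)
      have := ha p hp; split_ifs <;> linarith
    · show ∑ p ∈ V, (6 * a p + (if p = p₀ then Q - 6 * A else 0)) = Q
      rw [Finset.sum_add_distrib, ← Finset.mul_sum, Finset.sum_ite_eq' V p₀, if_pos hp₀, ← hA]; ring
    · show ∑ p ∈ V, max 0 (κ * ((6 * a p + (if p = p₀ then Q - 6 * A else 0)) / 6 - a p)) ≤ R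
      rw [← Finset.add_sum_erase V _ hp₀]
      have hoff : ∀ p ∈ V.erase p₀, max 0 (κ * ((6 * a p + (if p = p₀ then Q - 6 * A else 0)) / 6 - a p)) = 0 := by
        intro p hp
        rw [if_neg (Finset.ne_of_mem_erase hp)]
        refine max_eq_left (le_of_eq ?_)
        ring
      rw [Finset.sum_congr rfl hoff, Finset.sum_const_zero, add_zero, if_pos rfl]
      have h1 : κ * ((6 * a p₀ + (Q - 6 * A)) / 6 - a p₀) = κ * (Q / 6 - A) := by ring
      rw [h1]
      exact max_le hR hglob

/-! ## 2. The E5 spine from the ONE global inequality with NONNEGATIVE components -/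

/-- **THE E5 SPINE, ∃-FORM, ONE GLOBAL INEQUALITY — NONNEGATIVE COMPONENTS.** `ABC` follows if, per admissible `(λ, ℓ)` (classical layer
and Lemma-6.7.8 room GIVEN, as in p464392), the supplier returns (R1) the genuine tower + `L_mod`, (R2) a non-empty three-way `V`,
NONNEGATIVE `d_{L′}`-components `DLp p ≥ 0` with `Σ_{p∈V} DLp p = logDifferent K` (the genuine fibre sums qualify), and the ONE GLOBAL
inequality `−(1/2ℓ)·log 𝔮_F ≤ ((ℓ+1)/4)·{(1+4/ℓ)·logDifferent K − (1/6)·log 𝔮_F + (4/ℓ)·Σ_{p∈V} log p + (20/3)·e*_mod·Σ_{p∈V} ι_p·(log p)/p}`.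
The `q`-components handed to `abc_of_volFreeResidual` are the NONNEGATIVE ones of `exists_nonneg_qComponents` (capacity filling) — so the
collapse of `abc_of_genuineResidual`'s antecedent to the global inequality is NOT an artefact of signed components: it persists whenever the
`q`-components are free (nonnegative, fixed sum), whatever the `d_{L′}`-components. PROVED AS AN IMPLICATION (p464392 BY NAME); NO abc claim;
no side taken. [claim: Joshi2024ATS4, status: disputed] -/
theorem abc_of_globalInequality_nonneg
    (h : ∀ (d : ℕ), 0 < d → ∀ P ∈ UPle d, ∀ (ℓ : ℕ) (hℓ : ℓ.Prime) (h5 : 5 ≤ ℓ), IsLem587Prime d P ℓ → ITDConditions P ℓ →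
      AdmitsCore P → Real.log (4 * (2 ^ 12 * 3 ^ 3 * 5 * (d : ℝ)) * ℓ) ≤ 4 / 3 * ℓ →
        ∃ (F : Type) (_ : Field F) (_ : NumberField F) (_ : Algebra P.F F)
          (K : Type) (_ : Field K) (_ : NumberField K) (_ : Algebra F K) (_ : Algebra P.F K) (_ : IsScalarTower P.F F K)
          (_ : IsGalois F K) (ψ : K →ₐ[F] AlgebraicClosure F) (hU : P.InU) (_ : IsThetaField P F)
          (_ : letI := thetaCurve_isElliptic hU F
            ((thetaCurve P F).galoisRepTorsion (ℓ : ℤ)).ker ≤ ψ.fieldRange.fixingSubgroup)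
          (_ : 0 < (TateDivisorDatum.ofNFPointOver P {2, ℓ} F).logq)
          (Lmod : Type) (_ : Field Lmod) (_ : NumberField Lmod) (_ : Cor22.dmod P ≤ dMod Lmod) (_ : dMod Lmod ≤ d)
          (V : Finset ℕ) (_ : V.Nonempty)
          (_ : ∀ q ∈ V, q.Prime ∧ (q ∣ 2 * 3 * 5 * ℓ ∨ (∃ v ∈ badPlacesAvoid P {2, ℓ}, residueChar P.F v = q) ∨
            ∃ u : HeightOneSpectrum (𝓞 K), residueChar K u = q ∧ 2 ≤ u.asIdeal.ramificationIdx ℤ))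
          (DLp : ℕ → ℝ) (_ : ∀ p ∈ V, 0 ≤ DLp p) (_ : ∑ p ∈ V, DLp p = logDifferent K),
          -(1 / (2 * (ℓ : ℝ)) * (TateDivisorDatum.ofNFPointOver P {2, ℓ} F).logq) ≤
            ((ℓ : ℝ) + 1) / 4 *
              ((1 + 4 / (ℓ : ℝ)) * logDifferent K - 1 / 6 * (TateDivisorDatum.ofNFPointOver P {2, ℓ} F).logq
                + 4 / (ℓ : ℝ) * ∑ p ∈ V, Real.log p
                + 20 / 3 * ((2 ^ 12 * 3 ^ 3 * 5 * eMod Lmod : ℕ) : ℝ) *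
                  ∑ p ∈ V, (if p ≤ 2 ^ 12 * 3 ^ 3 * 5 * eMod Lmod * ℓ then Real.log p / p else 0))) : ABC := by
  refine abc_of_volFreeResidual fun d hd P hP ℓ hℓ h5 hℓP hITD hcore hroom => ?_
  obtain ⟨F, _, _, _, K, _, _, _, _, _, _, ψ, hU, hF, hK, hq, Lmod, _, _, hmod, hdmod, V, hVne, hV, DLp, hDLp0, hDLp, hglob⟩ :=
    h d hd P hP ℓ hℓ h5 hℓP hITD hcore hroom
  obtain ⟨p₀, hp₀⟩ := hVne
  have hℓpos : (0 : ℝ) < ℓ := by exact_mod_cast hℓ.pos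
  obtain ⟨Q, hQ⟩ : ∃ Q : ℝ, Q = (TateDivisorDatum.ofNFPointOver P {2, ℓ} F).logq := ⟨_, rfl⟩
  obtain ⟨E, hE⟩ : ∃ E : ℝ, E = ((2 ^ 12 * 3 ^ 3 * 5 * eMod Lmod : ℕ) : ℝ) := ⟨_, rfl⟩
  obtain ⟨c, hc⟩ : ∃ c : ℝ, c = 1 + 4 / (ℓ : ℝ) := ⟨_, rfl⟩
  obtain ⟨κ, hκ⟩ : ∃ κ : ℝ, κ = ((ℓ : ℝ) + 1) / 4 := ⟨_, rfl⟩
  obtain ⟨pos, hpos⟩ : ∃ pos : ℕ → ℝ, ∀ p, pos p = 4 / (ℓ : ℝ) * Real.log p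
      + 20 / 3 * E * (if p ≤ 2 ^ 12 * 3 ^ 3 * 5 * eMod Lmod * ℓ then Real.log p / p else 0) := ⟨fun p => _, fun p => rfl⟩
  have hcpos : 0 < c := by rw [hc]; positivity
  have hκnn : 0 ≤ κ := by rw [hκ]; positivity
  have hEnn : 0 ≤ E := by rw [hE]; positivity
  have hQpos : 0 < Q := by rw [hQ]; exact hq
  have hposnn : ∀ p ∈ V, 0 ≤ pos p := by
    intro p hp
    rw [hpos p]
    have hlog : 0 ≤ Real.log p := Real.log_natCast_nonneg p
    have hite : 0 ≤ (if p ≤ 2 ^ 12 * 3 ^ 3 * 5 * eMod Lmod * ℓ then Real.log p / p else 0) := by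
      split_ifs
      · exact div_nonneg hlog (Nat.cast_nonneg _)
      · exact le_rfl
    positivity
  -- absorptive terms `a p := c·DLp p + pos p ≥ 0`
  obtain ⟨a, ha⟩ : ∃ a : ℕ → ℝ, ∀ p, a p = c * DLp p + pos p := ⟨fun p => _, fun p => rfl⟩
  have hann : ∀ p ∈ V, 0 ≤ a p := fun p hp => by
    rw [ha p]; exact add_nonneg (mul_nonneg hcpos.le (hDLp0 p hp)) (hposnn p hp)
  have hsuma : ∑ p ∈ V, a p = c * logDifferent K + ∑ p ∈ V, pos p := by
    rw [Finset.sum_congr rfl fun p _ => ha p, Finset.sum_add_distrib, ← Finset.mul_sum, hDLp]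
  have hsumpos : ∑ p ∈ V, pos p = 4 / (ℓ : ℝ) * ∑ p ∈ V, Real.log p
      + 20 / 3 * E * ∑ p ∈ V, (if p ≤ 2 ^ 12 * 3 ^ 3 * 5 * eMod Lmod * ℓ then Real.log p / p else 0) := by
    rw [Finset.sum_congr rfl fun p _ => hpos p, Finset.sum_add_distrib, ← Finset.mul_sum, ← Finset.mul_sum]
  -- the global inequality in the lemma's shape
  have hglob' : κ * (Q / 6 - ∑ p ∈ V, a p) ≤ 1 / (2 * (ℓ : ℝ)) * Q := by
    rw [hsuma, hsumpos, hκ, hc]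
    rw [← hQ, ← hE] at hglob
    linarith
  have hRnn : 0 ≤ 1 / (2 * (ℓ : ℝ)) * Q := by positivity
  obtain ⟨qAt, hq0, hqsum, hqmax⟩ := exists_nonneg_qComponents V hp₀ a hann hκnn hQpos.le hRnn hglob'
  refine ⟨F, inferInstance, inferInstance, inferInstance, K, inferInstance, inferInstance, inferInstance, inferInstance,
    inferInstance, inferInstance, ψ, hU, hF, hK, hq, Lmod, inferInstance, inferInstance, hmod, hdmod, V, hV, DLp, qAt, hDLp,
    by rw [hqsum, hQ], ?_⟩
  -- the brackets: `−B_p = κ·(qAt p/6 − a p)`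
  have hshape : ∀ p, max 0 (-(((ℓ : ℝ) + 1) / 4 * ((1 + 4 / (ℓ : ℝ)) * DLp p - 1 / 6 * qAt p + 4 / (ℓ : ℝ) * Real.log p
      + 20 / 3 * ((2 ^ 12 * 3 ^ 3 * 5 * eMod Lmod : ℕ) : ℝ) *
        (if p ≤ 2 ^ 12 * 3 ^ 3 * 5 * eMod Lmod * ℓ then Real.log p / p else 0)))) = max 0 (κ * (qAt p / 6 - a p)) := by
    intro p
    congr 1
    rw [ha p, hpos p, hc, hκ, hE]
    ring
  rw [Finset.sum_congr rfl fun p _ => hshape p, ← hQ]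
  exact hqmax

end Summit.ABC.IUTFork.Joshi.ATS4

end
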